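import Literature.AlgebraicGeometry.Kawanoue2007.DSaturationLocalization
import Literature.AlgebraicGeometry.Resolution.SmoothImpliesRegular
import Literature.AlgebraicGeometry.Resolution.AdicCompletionRegular
import Mathlib.RingTheory.Spectrum.Maximal.Basic
import Mathlib.LinearAlgebra.FiniteDimensional.Basic
import Mathlib.Data.Fin.Tuple.Sort
import Mathlib.RingTheory.Jacobson.Ring
import Mathlib.Algebra.CharP.Algebra
import Mathlib.RingTheory.AdicCompletion.LocalRing
import Mathlib.RingTheory.AdicCompletion.Noetherian
import HarnessLib

/-!
# Kawanoue 2007, Part I, Prop. 3.1.3.2: a leading generator system EXISTS for a 𝔇-saturated idealistic filtration — NAMED FACT, DISCHARGED (`Kawanoue2007_prop_3_1_3_2_holds`), with the general existence theorem `exists_isLGS`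

H. Kawanoue, *Toward resolution of singularities over a field of positive characteristic. Part I. Foundation; the
language of the idealistic filtration*, Publ. RIMS **43** (2007) 819–909 (= arXiv:math/0607009) [Kawanoue2007], §3.1.3
(held arXiv text `lit read paper:arxiv-math-0607009`: Chapter 3 setting chunk p0077 L11; Def. 3.1.3.1 and
**Prop. 3.1.3.2** with its proof chunk p0082 L8–L17, re-read before typing). The tree's `LeadingGeneratorSystem.lean`
types Def. 3.1.3.1 (`IsLGS`) and says: «Prop. 3.1.3.2, the EXISTENCE of a leading generator system for a 𝔇-saturated
filtration over an algebraically closed field, is a theorem in print that is neither asserted nor assumed here». This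
file vendors that theorem as ONE named fact — originally statement only (p551010), now PROVED in this same file
(`Kawanoue2007_prop_3_1_3_2_holds`, p554080; see «Discharge» below) — because every pointwise statement of Part II
READS `μ̃(P)` ON an LGS of `𝕀_P` (`KawanoueMatsuki2010/InvariantsAtClosedPoint.lean`: Prop. 3.1.2.1, Prop. 3.3.1.1 over a SECTION of
LGS's, Thm. A.1.1.1 (1)) — with this fact (and Prop. 2.4.2.1 (2), PROVED in `DSaturationLocalization.lean`) such
sections exist, so those facts are not vacuous: the PROVED edge `Kawanoue2007_prop_3_1_3_2.exists_section` below has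
exactly the hypothesis shape of `KawanoueMatsuki2010_prop_3_3_1_1`. Campaign `res-hironaka` (D-0089), rung LIT-6.
(Historical note, p551010: the discharge route then envisaged was the FIRST part of Lemma 3.1.2.1 — the tree PROVES
its polynomial-ring form, `Resolution/DiffStableSubalgebra.lean`, `exists_eq_adjoin_pow_linearForms_of_isDiffStable_fin` —
via `L(𝕀) ⊂ G ≅ k[x_1, …, x_d]`; the discharge below instead follows the «Moreover» part of Lemma 3.1.2.1, which is all
that EXISTENCE needs, so no graded-ring structure on `⊕ 𝔪ⁿ/𝔪ⁿ⁺¹` is required. That `L(𝕀)` is GENERATED by a leading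
generator system when `𝕀` is 𝔇-saturated — the first part — is not asserted in this file.) Nothing of Hironaka's 2017
manuscript is referred to or asserted.

## Discharge (appended): `Kawanoue2007_prop_3_1_3_2_holds`

The fact is now PROVED in this file (`theorem Kawanoue2007_prop_3_1_3_2_holds`), following the printed proof —
Lemma 3.1.2.1, «Moreover» part (statement chunk p0080 L13; proof p0081 L27–p0082 L5), and Prop. 3.1.3.2
(proof p0082 L16): the pure parts `L(𝕀)^{pure}_{p^e}` are subspaces (`exists_submodule_coe_eq_pureLeading`;
«using the assumption that `k` is algebraically closed», p0080 L1) of dimension `≤ dim G_1` (`lPure_le_of_span_eq`; «the dimension of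
the pure part is uniformly bounded», p0081 L35), linked by `{L^{pure}_{p^{e-1}}}^p ⊂ L^{pure}_{p^e}`
(`pureLeading_pow`); bases are chosen stage by stage (`exists_partialLGS` = «take `V_i ⊂ G_1` inductively
so that `F^{e_i}(V_i) ∪ ⋃_{j<i} F^{e_i}(V_j)` forms a basis», p0081 L35–p0082 L3) and lifted to elements
`(h_{ij}, p^{e_i}) ∈ 𝕀` (Prop. 3.1.3.2, proof). The one input the text takes from `G ≅ k[x_1, …, x_d]` —
that the Frobenius of `G` keeps linearly independent families linearly independent — is proved on
representatives from the tree's order valuation of a REGULAR local ring (`indep_frobenius`,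
`Resolution/RegularLocalOrderValuation.lean`: `ord(g^p) = p · ord g`); above the stage where
`dim L^{pure}_{p^e}` is maximal the Frobenius images remain bases by a dimension count. The general
statement is `exists_isLGS`: ANY idealistic filtration over a regular local ring of exponential
characteristic `p` whose residue field has `p`-th roots admits a leading generator system indexed by
`Fin N` with monotone exponents; the fact's setting `R = A_𝔫` (`A` smooth of finite type over `k = k̄`) is a
regular local ring (`Resolution/SmoothImpliesRegular.lean`) with residue field `k` (Nullstellensatz). As the
tree's `IsLGS` docstring records, conditions (i)(ii) of Def. 3.1.3.1 do not involve 𝔇-saturation; the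
printed standing hypothesis «𝔇-saturated» enters Lemma 3.1.2.1 only through its first part
`L = k[L^{pure}]` (the system GENERATES `L(𝕀)`), which is neither needed nor asserted here — so the
discharge does not use the fact's hypothesis `IsDSaturated k 𝕀`.

Also appended (section `SigmaBounds`): the printed bounds on the pure dimensions — «`dim_k L(𝕀)^{pure}_{p^e} ≤ dim W`»
(Ch. 3 introduction, chunk p0079 L5) as `lPure_le_spanFinrank` / `lPure_le_ringKrullDim`, hence «`σ : ℤ_{≥0} → ℤ_{≥0}`»
(Def. 3.2.1.1) as `sigma_nonneg`; and Kawanoue–Matsuki 2010 Rem. 1.1.1.2 (2) (arXiv:math/0612008 chunk p0013 L24–L28: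
«the dimension of the pure part is non-decreasing as a function of `e` … uniformly bounded from above by `d = dim W`
… and hence stabilizes») as `lPure_le_lPure_succ`, `monotone_lPure`, `antitone_sigma`, `exists_forall_lPure_eq`; and (section `CardBound`)
«condition (ii) implies `#ℍ ≤ dim W`» (chunk p0079 L5): `IsWeakLGS.card_le_lPure`, `IsWeakLGS.card_le_spanFinrank`,
`IsLGS.card_le_spanFinrank`, `IsLGS.card_le_ringKrullDim`.

Also appended (section `Completion`): the «or its completion» clause of the Chapter 3 setting (chunk p0077 L11) for
Prop. 3.1.3.2 — `exists_isLGS_adicCompletion` (over the `𝔪`-adic completion of any regular local ring as above: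
`R̂` is regular, tree `Resolution.isRegularLocalRing_adicCompletion`, with the same residue field, Mathlib
`AdicCompletion.residueField_map_bijective`) and `Kawanoue2007_prop_3_1_3_2_adicCompletion` (the fact's setting
with `R = (A_𝔫)^`), closing the fact's `-- TODO(general form): R = Â_𝔫` by a theorem (no new fact).

Also appended (section `ClosedPoint`): the printed setting `R = 𝒪_{W,P}` for ANY filtration over `A_𝔫` —
`exists_isLGS_of_smooth` (Prop. 3.1.3.2 without the 𝔇-saturation binder; the form KM 2010 §3.1.1 uses, chunk
p0041 L25), `lPure_le_of_smooth` / `sigma_nonneg_of_smooth` with `d = dim A` («`≤ dim W`», «`σ(e) ∈ ℤ_{≥0}`»),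
`monotone_lPure_of_smooth`, `antitone_sigma_of_smooth`, `exists_forall_lPure_eq_of_smooth` (KM Rem. 1.1.1.2 (2)).

## The printed statement and how it is typed (faithfulness notes)

* **Setting of Chapter 3** (p0077 L11): «we consider an idealistic filtration `𝕀` over `R` where `R` is taken to be the
  localization at a maximal ideal corresponding to a closed point `P ∈ W` of the coordinate ring of an affine open
  subset of a variety `W` smooth over an algebraically closed field `k` of `char(k) = p ≥ 0`, or its completion». TYPED
  (as in `NonsingularityPrinciple.lean`): `k` algebraically closed with `ExpChar k p`, `A` a smooth finitely generated
  `k`-domain, `𝔫` maximal, `R = A_𝔫` (the fact's binder); the completion case «or its completion» is the theorem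
  `Kawanoue2007_prop_3_1_3_2_adicCompletion` (section `Completion` below).
* **Prop. 3.1.3.2** (p0082 L14): «A leading generator system exists for a 𝔇-saturated idealistic filtration `𝕀`» with
  Def. 3.1.3.1 (p0082 L8–L12) «`ℍ = {(h_{ij}, p^{e_i})} ⊂ 𝕀`» and the proof's «`{e_1 < ⋯ < e_N}` and
  `V_1 ⊔ ⋯ ⊔ V_N ⊂ G_1`» (finitely many elements, grouped by increasing exponent). TYPED: `∃ N (h : Fin N → R)
  (e : Fin N → ℕ), Monotone e ∧ IsLGS p 𝕀 h e` (the tree's `IsLGS`, one flattened index; `Monotone e` = the printed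
  grouping `e_1 ≤ ⋯`).

## References

* H. Kawanoue, Publ. RIMS 43 (2007) 819–909 = arXiv:math/0607009: Def. 3.1.3.1, Prop. 3.1.3.2 (with Lemma 3.1.2.1),
  Prop. 2.4.2.1 (2). [Kawanoue2007]
* H. Kawanoue, K. Matsuki, Publ. RIMS 46 (2010) = arXiv:math/0612008: §3.1.1 (an LGS of `𝕀_P` is taken at every closed
  point). [KawanoueMatsuki2010]
-/

noncomputable section

namespace Literature.AlgebraicGeometry.Kawanoue2007

open IsLocalRing

universe u

/-- NAMED FACT — **Kawanoue 2007, Proposition 3.1.3.2** [chunk p0082 L14]: «A leading generator system exists for a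
𝔇-saturated idealistic filtration `𝕀`.» Setting (p0077 L11): `R` the localization at a maximal ideal of the coordinate
ring of an affine open subset of a variety smooth over an algebraically closed field `k`, `char k = p ≥ 0` (`p = ∞`,
here `p = 1`, in characteristic zero). Vendored: for `k` algebraically closed with `ExpChar k p`, `A` a smooth finitely
generated `k`-domain, `𝔫 ⊂ A` maximal and a 𝔇-saturated idealistic filtration `𝕀` over `R = A_𝔫`, there are `N`,
`h : Fin N → R`, `e : Fin N → ℕ` monotone with `IsLGS p 𝕀 h e` (Def. 3.1.3.1). PROVED below:
`Kawanoue2007_prop_3_1_3_2_holds` (users may still take `(h : Kawanoue2007_prop_3_1_3_2)` and feed it `…_holds`); the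
general form is `exists_isLGS` (any regular local ring of exponential characteristic `p` with `p`-th roots in the residue
field, ANY idealistic filtration — the 𝔇-saturation binder kept here as printed is not used for existence), the printed
«or its completion» case is `Kawanoue2007_prop_3_1_3_2_adicCompletion` / `exists_isLGS_adicCompletion`, and the form
without the 𝔇-saturation binder in this setting is `exists_isLGS_of_smooth`.
[cite: Kawanoue2007, Prop. 3.1.3.2 (§3.1.3) with Def. 3.1.3.1] -/
def Kawanoue2007_prop_3_1_3_2 : Prop :=
  ∀ (p : ℕ) (k : Type u) [Field k] [IsAlgClosed k] [ExpChar k p]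
    (A : Type u) [CommRing A] [IsDomain A] [Algebra k A] [Algebra.FiniteType k A] [Algebra.Smooth k A]
    (𝔫 : Ideal A) [𝔫.IsMaximal]
    (𝕀 : IdealisticFiltration (Localization.AtPrime 𝔫)),
    IdealisticFiltration.IsDSaturated k 𝕀 →
      ∃ (N : ℕ) (h : Fin N → Localization.AtPrime 𝔫) (e : Fin N → ℕ), Monotone e ∧ IsLGS p 𝕀 h e

/-- **PROVED edge — LGS's of the localizations of a GLOBAL 𝔇-saturated filtration**: under the fact, a 𝔇-saturated
`𝕀` over the coordinate ring `A` has, at every maximal ideal `𝔫`, a finite leading generator system of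
`𝕀_𝔫 = 𝕀.atPrime 𝔫` — `𝕀_𝔫` is 𝔇-saturated by Prop. 2.4.2.1 (2) (`IsDSaturated.atPrime`, proved in
`DSaturationLocalization.lean`). This is the situation of Kawanoue–Matsuki 2010 §3.1.1 («Take a leading generator
system … for the 𝔇-saturated idealistic filtration `𝕀_P`»). [cite: Kawanoue2007, Prop. 3.1.3.2, Prop. 2.4.2.1 (2); KawanoueMatsuki2010, §3.1.1] -/
theorem Kawanoue2007_prop_3_1_3_2.exists_isLGS_atPrime (H : Kawanoue2007_prop_3_1_3_2.{u})
    (p : ℕ) (k : Type u) [Field k] [IsAlgClosed k] [ExpChar k p]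
    (A : Type u) [CommRing A] [IsDomain A] [Algebra k A] [Algebra.FiniteType k A] [Algebra.Smooth k A]
    (𝕀 : IdealisticFiltration A) (hD : IdealisticFiltration.IsDSaturated k 𝕀) (𝔫 : Ideal A) [𝔫.IsMaximal] :
    ∃ (N : ℕ) (h : Fin N → Localization.AtPrime 𝔫) (e : Fin N → ℕ), Monotone e ∧ IsLGS p (𝕀.atPrime 𝔫) h e :=
  H p k A 𝔫 (𝕀.atPrime 𝔫) (hD.atPrime k 𝔫)

/-- **PROVED edge — a SECTION of leading generator systems over the closed points exists** (one finite LGS of `𝕀_𝔫`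
for every `𝔫 ∈ MaximalSpectrum A`), for a 𝔇-saturated filtration over the coordinate ring: exactly the datum the
pointwise invariant `μ̃` is read on (KM 2010 Def. 3.1.1.1) and the hypothesis shape over which
`KawanoueMatsuki2010_prop_3_3_1_1` (upper semicontinuity of `(σ, μ̃)`) is quantified — so that statement is not
vacuous under this fact. [cite: Kawanoue2007, Prop. 3.1.3.2, Prop. 2.4.2.1 (2); KawanoueMatsuki2010, §3.1.1] -/
theorem Kawanoue2007_prop_3_1_3_2.exists_section (H : Kawanoue2007_prop_3_1_3_2.{u})
    (p : ℕ) (k : Type u) [Field k] [IsAlgClosed k] [ExpChar k p]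
    (A : Type u) [CommRing A] [IsDomain A] [Algebra k A] [Algebra.FiniteType k A] [Algebra.Smooth k A]
    (𝕀 : IdealisticFiltration A) (hD : IdealisticFiltration.IsDSaturated k 𝕀) :
    ∃ (N : MaximalSpectrum A → ℕ)
      (h : ∀ 𝔫 : MaximalSpectrum A, Fin (N 𝔫) → Localization.AtPrime 𝔫.asIdeal)
      (e : ∀ 𝔫 : MaximalSpectrum A, Fin (N 𝔫) → ℕ),
      ∀ 𝔫, Monotone (e 𝔫) ∧ IsLGS p (𝕀.atPrime 𝔫.asIdeal) (h 𝔫) (e 𝔫) := by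
  choose N h e hmono hLGS using
    fun 𝔫 : MaximalSpectrum A => H.exists_isLGS_atPrime p k A 𝕀 hD 𝔫.asIdeal
  exact ⟨N, h, e, fun 𝔫 => ⟨hmono 𝔫, hLGS 𝔫⟩⟩

open Literature.AlgebraicGeometry.Resolution (adicOrder le_adicOrder_iff adicOrder_pow)
open Literature.RingTheory.HilbertSamuel (gradedPiece gradedPiece.mk)

/-! ## Proofs (appended): the «Moreover» part of Lemma 3.1.2.1 and Prop. 3.1.3.2 -/

section GradedPieceLemmas

variable {R : Type u} [CommRing R] [IsLocalRing R]

/-- `r̄ • [x] = [r x]` in `𝔪ⁿ/𝔪ⁿ⁺¹`. [folklore] -/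
private theorem residue_smul_mk (n : ℕ) (r : R) (x : ↥(maximalIdeal R ^ n)) :
    residue R r • gradedPiece.mk (maximalIdeal R) n x = gradedPiece.mk (maximalIdeal R) n (r • x) := by
  rw [map_smul]
  exact algebraMap_smul (ResidueField R) r _

/-- `∑ r̄ᵢ • [xᵢ] = [∑ rᵢ xᵢ]` in `𝔪ⁿ/𝔪ⁿ⁺¹`. [folklore] -/
private theorem sum_residue_smul_mk (n : ℕ) {ι : Type*} (s : Finset ι) (r : ι → R)
    (x : ι → ↥(maximalIdeal R ^ n)) :
    ∑ i ∈ s, residue R (r i) • gradedPiece.mk (maximalIdeal R) n (x i) =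
      gradedPiece.mk (maximalIdeal R) n (∑ i ∈ s, r i • x i) := by
  rw [map_sum]
  exact Finset.sum_congr rfl fun i _ => residue_smul_mk n (r i) (x i)

/-- `[x] = [y]` in `𝔪ⁿ/𝔪ⁿ⁺¹` iff `x - y ∈ 𝔪ⁿ⁺¹`. [folklore] -/
private theorem mk_eq_mk_iff (n : ℕ) (x y : ↥(maximalIdeal R ^ n)) :
    gradedPiece.mk (maximalIdeal R) n x = gradedPiece.mk (maximalIdeal R) n y ↔
      (x : R) - y ∈ maximalIdeal R ^ (n + 1) := by
  rw [← sub_eq_zero, ← map_sub, gradedPiece.mk_eq_zero_iff]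
  rfl

/-- **Linear independence in `G_n = 𝔪ⁿ/𝔪ⁿ⁺¹` read on representatives**: the classes of
`f_i ∈ 𝔪ⁿ` are linearly independent over the residue field iff every relation
`∑ r_i f_i ∈ 𝔪ⁿ⁺¹` (`r_i ∈ R`) has all `r_i ∈ 𝔪`. [folklore] -/
private theorem linearIndependent_mk_iff {ι : Type*} (n : ℕ) (f : ι → R)
    (hf : ∀ i, f i ∈ maximalIdeal R ^ n) :
    LinearIndependent (ResidueField R) (fun i => gradedPiece.mk (maximalIdeal R) n ⟨f i, hf i⟩) ↔
      ∀ (s : Finset ι) (r : ι → R), (∑ i ∈ s, r i * f i) ∈ maximalIdeal R ^ (n + 1) →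
        ∀ i ∈ s, r i ∈ maximalIdeal R := by
  have hcoe : ∀ (s : Finset ι) (r : ι → R),
      ((∑ i ∈ s, r i • (⟨f i, hf i⟩ : ↥(maximalIdeal R ^ n)) : ↥(maximalIdeal R ^ n)) : R) =
        ∑ i ∈ s, r i * f i := fun s r => by
    simp
  rw [linearIndependent_iff']
  constructor
  · intro H s r hsum i hi
    have h0 : ∑ i ∈ s, residue R (r i) • gradedPiece.mk (maximalIdeal R) n ⟨f i, hf i⟩ = 0 := by
      rw [sum_residue_smul_mk, gradedPiece.mk_eq_zero_iff, hcoe]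
      exact hsum
    exact (residue_eq_zero_iff _).mp (H s _ h0 i hi)
  · intro H s g hsum i hi
    choose r hr using fun i => residue_surjective (R := R) (g i)
    have hg : g = fun i => residue R (r i) := funext fun i => (hr i).symm
    rw [hg, sum_residue_smul_mk, gradedPiece.mk_eq_zero_iff, hcoe] at hsum
    rw [← hr i]
    exact (residue_eq_zero_iff _).mpr (H s r hsum i hi)

/-- Linear dependence is reflected by `p^j`-th powers (any local ring): if every relation
`∑ r_i f_i^{p^j} ∈ 𝔪^{n p^j + 1}` forces `r_i ∈ 𝔪`, then so does every relation
`∑ r_i f_i ∈ 𝔪ⁿ⁺¹` — `(∑ r_i f_i)^{p^j} = ∑ r_i^{p^j} f_i^{p^j}` in exponential characteristic `p`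
and `𝔪` is radical. [folklore] -/
private theorem indep_of_indep_pow (p : ℕ) [ExpChar R p] {ι : Type*} (n j : ℕ) (f : ι → R)
    (H : ∀ (s : Finset ι) (r : ι → R), (∑ i ∈ s, r i * (f i) ^ p ^ j) ∈
      maximalIdeal R ^ (n * p ^ j + 1) → ∀ i ∈ s, r i ∈ maximalIdeal R) :
    ∀ (s : Finset ι) (r : ι → R), (∑ i ∈ s, r i * f i) ∈ maximalIdeal R ^ (n + 1) →
      ∀ i ∈ s, r i ∈ maximalIdeal R := by
  intro s r hsum i hi
  have h1 : (∑ i ∈ s, r i * f i) ^ p ^ j = ∑ i ∈ s, (r i) ^ p ^ j * (f i) ^ p ^ j := by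
    rw [sum_pow_char_pow p j]
    exact Finset.sum_congr rfl fun i _ => mul_pow _ _ _
  have h2 : (∑ i ∈ s, (r i) ^ p ^ j * (f i) ^ p ^ j) ∈ maximalIdeal R ^ (n * p ^ j + 1) := by
    rw [← h1]
    have h := Ideal.pow_mem_pow hsum (p ^ j)
    rw [← pow_mul] at h
    refine Ideal.pow_le_pow_right ?_ h
    have : 1 ≤ p ^ j := Nat.one_le_pow _ _ (expChar_pos R p)
    nlinarith
  have h3 := H s (fun i => (r i) ^ p ^ j) h2 i hi
  exact (Ideal.IsPrime.pow_mem_iff_mem inferInstance _ (pow_pos (expChar_pos R p) j)).mp h3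

end GradedPieceLemmas

section Regular

variable {R : Type u} [CommRing R] [IsRegularLocalRing R]

/-- In a regular local ring, `g^p ∈ 𝔪^{np+1}` (`p ≥ 1`) forces `g ∈ 𝔪ⁿ⁺¹`: the order function is a
valuation, `ord(g^p) = p · ord(g)`. [cite: ZariskiSamuel1960, Ch. VIII §1 Thm. 1] -/
theorem mem_pow_succ_of_pow_mem_pow {p n : ℕ} {g : R}
    (hg : g ^ p ∈ maximalIdeal R ^ (n * p + 1)) : g ∈ maximalIdeal R ^ (n + 1) := by
  rw [← le_adicOrder_iff] at hg ⊢
  rw [adicOrder_pow] at hg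
  rcases eq_or_ne (adicOrder g) ⊤ with htop | hne
  · rw [htop]; exact le_top
  obtain ⟨m, hm⟩ := ENat.ne_top_iff_exists.mp hne
  rw [← hm] at hg ⊢
  have h1 : n * p + 1 ≤ p * m := by exact_mod_cast hg
  have h2 : n + 1 ≤ m := by
    by_contra h
    rw [not_le] at h
    have h3 : p * m ≤ p * n := Nat.mul_le_mul_left p (by omega)
    have h4 := h1.trans h3
    rw [mul_comm p n] at h4
    omega
  exact_mod_cast h2

/-- **The Frobenius of `G = gr_𝔪(R)` preserves linear independence** (`R` regular local of
exponential characteristic `p`, residue field with `p`-th roots), read on representatives: if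
every relation `∑ r_i f_i ∈ 𝔪ⁿ⁺¹` among `f_i ∈ 𝔪ⁿ` forces all `r_i ∈ 𝔪`, then every relation
`∑ r_i f_i^p ∈ 𝔪^{np+1}` forces all `r_i ∈ 𝔪`. Printed use: «`{L^{pure}_{p^{e-1}}}^p ⊂ L^{pure}_{p^e}`»
with `dim` non-decreasing, `G ≅ k[x_1, …, x_d]` a domain. [cite: Kawanoue2007, Lemma 3.1.2.1 (proof, «Moreover» part)] -/
theorem indep_frobenius (p : ℕ) [ExpChar R p] (hF : ∀ c : ResidueField R, ∃ d, d ^ p = c)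
    {ι : Type*} (n : ℕ) (f : ι → R) (hf : ∀ i, f i ∈ maximalIdeal R ^ n)
    (H : ∀ (s : Finset ι) (r : ι → R), (∑ i ∈ s, r i * f i) ∈ maximalIdeal R ^ (n + 1) →
      ∀ i ∈ s, r i ∈ maximalIdeal R) :
    ∀ (s : Finset ι) (r : ι → R), (∑ i ∈ s, r i * (f i) ^ p) ∈ maximalIdeal R ^ (n * p + 1) →
      ∀ i ∈ s, r i ∈ maximalIdeal R := by
  intro s r hsum i hi
  have hp : 0 < p := expChar_pos R p
  -- `p`-th roots of the residues of the coefficients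
  have hroot : ∀ i, ∃ t : R, t ^ p - r i ∈ maximalIdeal R := fun i => by
    obtain ⟨d, hd⟩ := hF (residue R (r i))
    obtain ⟨t, rfl⟩ := residue_surjective (R := R) d
    refine ⟨t, ?_⟩
    rw [← residue_eq_zero_iff, map_sub, map_pow, hd, sub_self]
  choose t ht using hroot
  have key : (∑ i ∈ s, t i * f i) ^ p ∈ maximalIdeal R ^ (n * p + 1) := by
    have h1 : (∑ i ∈ s, t i * f i) ^ p = ∑ i ∈ s, (t i) ^ p * (f i) ^ p := by
      rw [sum_pow_char p]
      exact Finset.sum_congr rfl fun i _ => mul_pow _ _ _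
    have h2 : ∑ i ∈ s, (t i) ^ p * (f i) ^ p =
        ∑ i ∈ s, r i * (f i) ^ p + ∑ i ∈ s, ((t i) ^ p - r i) * (f i) ^ p := by
      rw [← Finset.sum_add_distrib]
      exact Finset.sum_congr rfl fun i _ => by ring
    rw [h1, h2]
    refine add_mem hsum (sum_mem fun i _ => ?_)
    rw [pow_succ']
    refine Ideal.mul_mem_mul (ht i) ?_
    have h := Ideal.pow_mem_pow (hf i) p
    rwa [← pow_mul] at h
  have key2 : (∑ i ∈ s, t i * f i) ∈ maximalIdeal R ^ (n + 1) := mem_pow_succ_of_pow_mem_pow key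
  have hti : t i ∈ maximalIdeal R := H s t key2 i hi
  have htp : (t i) ^ p ∈ maximalIdeal R := Ideal.pow_mem_of_mem _ hti p hp
  simpa using sub_mem htp (ht i)

/-- Iterated form of `indep_frobenius`: `p^j`-th powers. [cite: Kawanoue2007, Lemma 3.1.2.1 (proof, «Moreover» part)] -/
theorem indep_frobenius_pow (p : ℕ) [ExpChar R p] (hF : ∀ c : ResidueField R, ∃ d, d ^ p = c)
    {ι : Type*} (n : ℕ) (f : ι → R) (hf : ∀ i, f i ∈ maximalIdeal R ^ n)
    (H : ∀ (s : Finset ι) (r : ι → R), (∑ i ∈ s, r i * f i) ∈ maximalIdeal R ^ (n + 1) →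
      ∀ i ∈ s, r i ∈ maximalIdeal R) (j : ℕ) :
    ∀ (s : Finset ι) (r : ι → R), (∑ i ∈ s, r i * (f i) ^ p ^ j) ∈
      maximalIdeal R ^ (n * p ^ j + 1) → ∀ i ∈ s, r i ∈ maximalIdeal R := by
  induction j with
  | zero => simpa using H
  | succ j ih =>
    have hf' : ∀ i, f i ^ p ^ j ∈ maximalIdeal R ^ (n * p ^ j) := fun i => by
      have := Ideal.pow_mem_pow (hf i) (p ^ j)
      rwa [← pow_mul] at this
    have := indep_frobenius p hF (n * p ^ j) (fun i => f i ^ p ^ j) hf' ih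
    have e1 : ∀ i, (f i ^ p ^ j) ^ p = f i ^ p ^ (j + 1) := fun i => by rw [← pow_mul, ← pow_succ]
    have e2 : n * p ^ j * p = n * p ^ (j + 1) := by rw [mul_assoc, ← pow_succ]
    simp only [e1, e2] at this
    exact this

end Regular

section Pure

variable {R : Type u} [CommRing R] [IsLocalRing R]

/-- `p^e`-th roots in the residue field from `p`-th roots. [folklore] -/
private theorem exists_pow_pow_eq {F : Type*} [Monoid F] {p : ℕ} (hF : ∀ c : F, ∃ d, d ^ p = c)
    (e : ℕ) (c : F) : ∃ d, d ^ p ^ e = c := by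
  induction e generalizing c with
  | zero => exact ⟨c, by simp⟩
  | succ e ih =>
    obtain ⟨d, rfl⟩ := hF c
    obtain ⟨d', rfl⟩ := ih d
    exact ⟨d', by rw [pow_succ, pow_mul]⟩

/-- **`{L(𝕀)^{pure}_{p^e}}^{p^j} ⊂ L(𝕀)^{pure}_{p^{e+j}}`** on representatives: if `h ∈ 𝔪^{p^e}`,
`(h, p^e) ∈ 𝕀` and `h̄` is pure, then `h^{p^j} ∈ 𝔪^{p^{e+j}}`, `(h^{p^j}, p^{e+j}) ∈ 𝕀` and
`\overline{h^{p^j}} = \bar v^{p^{e+j}}` is pure (exponential characteristic `p`: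
`(h - v^{p^e})^{p^j} = h^{p^j} - v^{p^{e+j}}`). [cite: Kawanoue2007, Lemma 3.1.2.1 (proof, «sequence of inclusions among the pure parts»)] -/
theorem pureLeading_pow (p : ℕ) [ExpChar R p] (𝕀 : IdealisticFiltration R) {e j e' : ℕ} (hee' : e + j = e')
    {h : R} (hm : h ∈ maximalIdeal R ^ p ^ e) (hl : h ∈ 𝕀.level ((p ^ e : ℕ) : ℝ))
    (hpure : IsPure (p ^ e) (gradedPiece.mk (maximalIdeal R) (p ^ e) ⟨h, hm⟩)) :
    ∃ hm' : h ^ p ^ j ∈ maximalIdeal R ^ p ^ e',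
      h ^ p ^ j ∈ 𝕀.level ((p ^ e' : ℕ) : ℝ) ∧
      IsPure (p ^ e') (gradedPiece.mk (maximalIdeal R) (p ^ e') ⟨h ^ p ^ j, hm'⟩) := by
  subst hee'
  have hm' : h ^ p ^ j ∈ maximalIdeal R ^ p ^ (e + j) := by
    have := Ideal.pow_mem_pow hm (p ^ j)
    rwa [← pow_mul, ← pow_add] at this
  refine ⟨hm', ?_, ?_⟩
  · have := 𝕀.pow_mem hl (p ^ j)
    have hcast : ((p ^ j : ℕ) : ℝ) * ((p ^ e : ℕ) : ℝ) = ((p ^ (e + j) : ℕ) : ℝ) := by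
      push_cast
      ring
    rwa [hcast] at this
  · obtain ⟨v, hv, hvh⟩ := hpure
    refine ⟨v, hv, ?_⟩
    rw [mk_eq_mk_iff] at hvh ⊢
    -- `hvh : v^{p^e} - h ∈ 𝔪^{p^e+1}`; goal: `v^{p^{e+j}} - h^{p^j} ∈ 𝔪^{p^{e+j}+1}`
    have h1 : (v ^ p ^ (e + j) - (h ^ p ^ j) : R) = (v ^ p ^ e - h) ^ p ^ j := by
      rw [sub_pow_expChar_pow, ← pow_mul, ← pow_add]
    change v ^ p ^ (e + j) - h ^ p ^ j ∈ _
    rw [h1]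
    have h2 := Ideal.pow_mem_pow hvh (p ^ j)
    rw [← pow_mul] at h2
    refine Ideal.pow_le_pow_right ?_ h2
    have : 1 ≤ p ^ j := Nat.one_le_pow _ _ (expChar_pos R p)
    calc p ^ (e + j) + 1 = p ^ e * p ^ j + 1 := by rw [pow_add]
      _ ≤ (p ^ e + 1) * p ^ j := by nlinarith

/-- Over a residue field with `p^e`-th roots (e.g. `k` algebraically closed, as in print), the pure
part `L(𝕀)^{pure}_{p^e} = L(𝕀)_{p^e} ∩ F^e(G_1)` is a SUBSPACE of `G_{p^e}`: «Using the assumption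
that `k` is algebraically closed, we also see that `L(𝕀)^{pure}_{p^e}` is a `k`-vector subspace».
[cite: Kawanoue2007, §3.1.1 (after Rem. 3.1.1.2)] -/
theorem exists_submodule_coe_eq_pureLeading (p : ℕ) [ExpChar R p]
    (hF : ∀ c : ResidueField R, ∃ d, d ^ p = c) (𝕀 : IdealisticFiltration R) (e : ℕ) :
    ∃ S : Submodule (ResidueField R) (gradedPiece (maximalIdeal R) (p ^ e)),
      (S : Set (gradedPiece (maximalIdeal R) (p ^ e))) = pureLeading 𝕀 (p ^ e) := by
  have hq : p ^ e ≠ 0 := (pow_pos (expChar_pos R p) e).ne'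
  refine ⟨{ carrier := pureLeading 𝕀 (p ^ e)
            zero_mem' := ?zero
            add_mem' := fun {w₁ w₂} hw₁ hw₂ => ?add
            smul_mem' := fun c w hw => ?smul }, rfl⟩
  case zero =>
    refine ⟨Submodule.zero_mem _, 0, Submodule.zero_mem _, ?_⟩
    have : (⟨(0 : R) ^ p ^ e, Ideal.pow_mem_pow (Submodule.zero_mem (maximalIdeal R)) (p ^ e)⟩ :
        ↥(maximalIdeal R ^ p ^ e)) = 0 := Subtype.ext (zero_pow hq)
    rw [this, map_zero]
  case add =>
    obtain ⟨h₁, v₁, hv₁, rfl⟩ := hw₁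
    obtain ⟨h₂, v₂, hv₂, rfl⟩ := hw₂
    refine ⟨Submodule.add_mem _ h₁ h₂, v₁ + v₂, Submodule.add_mem _ hv₁ hv₂, ?_⟩
    rw [← map_add]
    congr 1
    exact Subtype.ext (add_pow_expChar_pow v₁ v₂ p e)
  case smul =>
    obtain ⟨hw, v, hv, rfl⟩ := hw
    obtain ⟨d, hd⟩ := exists_pow_pow_eq hF e c
    obtain ⟨t, rfl⟩ := residue_surjective (R := R) d
    refine ⟨Submodule.smul_mem _ _ hw, t * v, Ideal.mul_mem_left _ t hv, ?_⟩
    rw [← hd, ← map_pow, residue_smul_mk]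
    congr 1
    exact Subtype.ext (mul_pow t v (p ^ e))

/-- With the pure part a subspace, `l^{pure}_{p^e} = dim L(𝕀)^{pure}_{p^e}` is its dimension.
[cite: Kawanoue2007, Def. 3.2.1.1] -/
theorem lPure_eq_finrank_of_coe_eq {𝕀 : IdealisticFiltration R} {q : ℕ}
    {S : Submodule (ResidueField R) (gradedPiece (maximalIdeal R) q)}
    (hS : (S : Set (gradedPiece (maximalIdeal R) q)) = pureLeading 𝕀 q) :
    lPure 𝕀 q = Module.finrank (ResidueField R) S := by
  rw [lPure, ← hS, Submodule.span_eq]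

/-- **`dim_k L(𝕀)^{pure}_{p^e} ≤ dim W`** in the form: if `𝔪 = (x_1, …, x_n)` then
`l^{pure}_{p^e} ≤ n`, since every pure class `\bar v^{p^e}`, `v = ∑ a_i x_i`, equals
`∑ \bar a_i^{p^e} \bar x_i^{p^e}` (exponential characteristic `p`). [cite: Kawanoue2007, Ch. 3 introduction («Note that we have dim_k L(𝕀)^{pure}_{p^e} ≤ dim W»); Lemma 3.1.2.1 (proof)] -/
theorem lPure_le_of_span_eq (p : ℕ) [ExpChar R p] (𝕀 : IdealisticFiltration R) {n : ℕ}
    (x : Fin n → R) (hx : Ideal.span (Set.range x) = maximalIdeal R) (e : ℕ) :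
    lPure 𝕀 (p ^ e) ≤ n := by
  have hxm : ∀ i, x i ∈ maximalIdeal R := fun i => hx ▸ Ideal.subset_span ⟨i, rfl⟩
  let g : Fin n → gradedPiece (maximalIdeal R) (p ^ e) := fun i =>
    gradedPiece.mk (maximalIdeal R) (p ^ e) ⟨x i ^ p ^ e, Ideal.pow_mem_pow (hxm i) _⟩
  have hsub : pureLeading 𝕀 (p ^ e) ⊆
      (Submodule.span (ResidueField R) (Set.range g) : Set (gradedPiece (maximalIdeal R) (p ^ e))) := by
    rintro w ⟨-, v, hv, rfl⟩
    rw [← hx] at hv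
    obtain ⟨c, hc⟩ := Ideal.mem_span_range_iff_exists_fun.mp hv
    have hvq : (⟨v ^ p ^ e, Ideal.pow_mem_pow (hx ▸ hv) (p ^ e)⟩ : ↥(maximalIdeal R ^ p ^ e)) =
        ∑ i, (c i) ^ p ^ e • (⟨x i ^ p ^ e, Ideal.pow_mem_pow (hxm i) _⟩ : ↥(maximalIdeal R ^ p ^ e)) := by
      apply Subtype.ext
      simp only [← hc, sum_pow_char_pow p e, mul_pow]
      simp
    rw [hvq, ← sum_residue_smul_mk]
    exact Submodule.sum_mem _ fun i _ => Submodule.smul_mem _ _ (Submodule.subset_span ⟨i, rfl⟩)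
  haveI : Module.Finite (ResidueField R) (Submodule.span (ResidueField R) (Set.range g)) :=
    Module.Finite.span_of_finite _ (Set.finite_range g)
  calc lPure 𝕀 (p ^ e)
      ≤ Module.finrank (ResidueField R) (Submodule.span (ResidueField R) (Set.range g)) :=
        Submodule.finrank_mono (Submodule.span_le.mpr hsub)
    _ ≤ Fintype.card (Fin n) := finrank_range_le_card g
    _ = n := Fintype.card_fin n

/-- Hence, for a Noetherian local ring, the `l^{pure}_{p^e}` (`e ≥ 0`) are uniformly bounded and a
maximum is attained at some stage `E` — «the dimension of the pure part is uniformly bounded».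
[cite: Kawanoue2007, Lemma 3.1.2.1 (proof, «Moreover» part)] -/
theorem exists_forall_lPure_le [IsNoetherianRing R] (p : ℕ) [ExpChar R p] (𝕀 : IdealisticFiltration R) :
    ∃ E : ℕ, ∀ e : ℕ, lPure 𝕀 (p ^ e) ≤ lPure 𝕀 (p ^ E) := by
  obtain ⟨n, x, hx⟩ := Submodule.fg_iff_exists_fin_generating_family.mp
    (IsNoetherian.noetherian (maximalIdeal R))
  have hb : ∀ e, lPure 𝕀 (p ^ e) ≤ n := fun e => lPure_le_of_span_eq p 𝕀 x hx e
  have hfin : (Set.range fun e : ℕ => lPure 𝕀 (p ^ e)).Finite :=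
    (Set.finite_Iic n).subset (by rintro _ ⟨e, rfl⟩; exact hb e)
  obtain ⟨_, ⟨E, rfl⟩, hE⟩ := Set.exists_max_image _ id hfin ⟨_, 0, rfl⟩
  exact ⟨E, fun e => hE _ ⟨e, rfl⟩⟩

end Pure

/-! ## Kawanoue 2007, Lemma 3.1.2.1 («Moreover» part) and Prop. 3.1.3.2: a leading generator system exists -/

section Existence

/-- Re-indexing a leading generator system along a bijection of index types.
[cite: Kawanoue2007, Def. 3.1.3.1] -/
theorem IsLGS.comp_equiv {R : Type*} [CommRing R] [IsLocalRing R] {p : ℕ} {𝕀 : IdealisticFiltration R}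
    {ι κ : Type*} {h : ι → R} {e : ι → ℕ} (H : IsLGS p 𝕀 h e) (σ : κ ≃ ι) :
    IsLGS p 𝕀 (h ∘ σ) (e ∘ σ) := by
  have key : ∀ e₀ : ℕ, ∃ g : {j : κ // (e ∘ σ) j ≤ e₀} → {i : ι // e i ≤ e₀},
      Function.Bijective g ∧ lgsFamily p (h ∘ σ) (e ∘ σ) (fun j => H.pow_mem (σ j)) e₀ =
        lgsFamily p h e H.pow_mem e₀ ∘ g := fun e₀ =>
    ⟨fun j => ⟨σ j, j.2⟩,
      ⟨fun j₁ j₂ hj => Subtype.ext (σ.injective (congrArg Subtype.val hj)),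
        fun i => ⟨⟨σ.symm i, by simpa using i.2⟩, Subtype.ext (σ.apply_symm_apply i)⟩⟩, rfl⟩
  refine { level_mem := fun j => H.level_mem (σ j)
           pow_mem := fun j => H.pow_mem (σ j)
           pure := fun j => H.pure (σ j)
           injective := fun e₀ => ?_
           linearIndependent := fun e₀ => ?_
           span_eq := fun e₀ => ?_ }
  · obtain ⟨g, hg, hfam⟩ := key e₀
    rw [hfam]
    exact (H.injective e₀).comp hg.1
  · obtain ⟨g, hg, hfam⟩ := key e₀
    rw [hfam]
    exact (H.linearIndependent e₀).comp g hg.1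
  · obtain ⟨g, hg, hfam⟩ := key e₀
    rw [hfam, hg.2.range_comp]
    exact H.span_eq e₀

variable {R : Type u} [CommRing R] [IsRegularLocalRing R]

/-- The inductive step of the printed proof («take `V_i ⊂ G_1` inductively so that
`F^{e_i}(V_i) ∪ ⋃_{j<i} F^{e_i}(V_j)` forms a basis of `L^{pure}_{p^{e_i}}`»): a PARTIAL leading
generator system through the stages `e₀ < E` — finitely many `(h_i, p^{e_i}) ∈ 𝕀`, `e_i < E`, with
`h̄_i` pure and, for every `e₀ < E`, `{h̄_i^{p^{e₀-e_i}} ; e_i ≤ e₀}` a basis of `L(𝕀)^{pure}_{p^{e₀}}`.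
At stage `E` the Frobenius images of the stage-`E-1` basis stay linearly independent (`R` regular:
`indep_frobenius`) and are completed to a basis by classes of new elements `(h, p^E) ∈ 𝕀`.
[cite: Kawanoue2007, Lemma 3.1.2.1 (proof, «Moreover» part); Prop. 3.1.3.2 (proof)] -/
private theorem exists_partialLGS (p : ℕ) [ExpChar R p] (hF : ∀ c : ResidueField R, ∃ d, d ^ p = c)
    (𝕀 : IdealisticFiltration R) (E : ℕ) :
    ∃ (ι : Type u) (_ : Finite ι) (h : ι → R) (e : ι → ℕ)
      (hpow : ∀ i, h i ∈ maximalIdeal R ^ p ^ e i),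
      (∀ i, e i < E) ∧ (∀ i, h i ∈ 𝕀.level ((p ^ e i : ℕ) : ℝ)) ∧
      (∀ i, IsPure (p ^ e i) (gradedPiece.mk (maximalIdeal R) (p ^ e i) ⟨h i, hpow i⟩)) ∧
      ∀ e₀ < E, LinearIndependent (ResidueField R) (lgsFamily p h e hpow e₀) ∧
        (Submodule.span (ResidueField R) (Set.range (lgsFamily p h e hpow e₀)) :
          Set (gradedPiece (maximalIdeal R) (p ^ e₀))) = pureLeading 𝕀 (p ^ e₀) := by
  induction E with
  | zero =>
    exact ⟨PEmpty.{u + 1}, inferInstance, PEmpty.elim, PEmpty.elim, fun i => i.elim,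
      fun i => i.elim, fun i => i.elim, fun i => i.elim, fun e₀ he₀ => (Nat.not_lt_zero _ he₀).elim⟩
  | succ E ih =>
    obtain ⟨ι, _, h, e, hpow, hlt, hlev, hpure, hlow⟩ := ih
    have hle : ∀ i, e i ≤ E := fun i => (hlt i).le
    -- the old system read at stage `E`: `u i = \bar{h_i}^{p^{E - e_i}} ∈ G_{p^E}`
    have hupow : ∀ i, h i ^ p ^ (E - e i) ∈ maximalIdeal R ^ p ^ E := fun i =>
      pow_mem_pow_of_le p (hle i) (hpow i)
    let u : ι → gradedPiece (maximalIdeal R) (p ^ E) := fun i =>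
      gradedPiece.mk (maximalIdeal R) (p ^ E) ⟨h i ^ p ^ (E - e i), hupow i⟩
    have hu_mem : ∀ i, u i ∈ pureLeading 𝕀 (p ^ E) := fun i => by
      obtain ⟨hm', hl', hp'⟩ :=
        pureLeading_pow p 𝕀 (Nat.add_sub_cancel' (hle i)) (hpow i) (hlev i) (hpure i)
      exact ⟨mk_mem_leadingModule hm' hl', hp'⟩
    -- Frobenius keeps the stage-`E-1` basis linearly independent
    have hu_li : LinearIndependent (ResidueField R) u := by
      rcases Nat.eq_zero_or_pos E with hE | hE
      · haveI : IsEmpty ι := ⟨fun i => by have := hlt i; omega⟩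
        exact linearIndependent_empty_type
      · obtain ⟨hli, -⟩ := hlow (E - 1) (by omega)
        have hm1 : ∀ i, h i ^ p ^ (E - 1 - e i) ∈ maximalIdeal R ^ p ^ (E - 1) := fun i =>
          pow_mem_pow_of_le p (by have := hlt i; omega) (hpow i)
        have hli' : LinearIndependent (ResidueField R) (fun i : ι =>
            gradedPiece.mk (maximalIdeal R) (p ^ (E - 1)) ⟨h i ^ p ^ (E - 1 - e i), hm1 i⟩) :=
          hli.comp (fun i : ι => (⟨i, by have := hlt i; omega⟩ : {i : ι // e i ≤ E - 1}))
            fun i₁ i₂ h12 => by simpa using congrArg Subtype.val h12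
        have hcrit := (linearIndependent_mk_iff (p ^ (E - 1)) _ hm1).mp hli'
        have hcrit2 := indep_frobenius p hF (p ^ (E - 1)) _ hm1 hcrit
        have e1 : ∀ i, (h i ^ p ^ (E - 1 - e i)) ^ p = h i ^ p ^ (E - e i) := fun i => by
          rw [← pow_mul, ← pow_succ]
          congr 2
          have := hlt i
          omega
        have e2 : p ^ (E - 1) * p = p ^ E := by
          rw [← pow_succ]
          congr 1
          omega
        simp only [e1, e2] at hcrit2
        exact (linearIndependent_mk_iff (p ^ E) _ hupow).mpr hcrit2
    -- complete `{u i}` to a basis of the pure part `L(𝕀)^{pure}_{p^E}` (a subspace)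
    obtain ⟨S, hS⟩ := exists_submodule_coe_eq_pureLeading p hF 𝕀 E
    have hsub : Set.range u ⊆ pureLeading 𝕀 (p ^ E) := by
      rintro _ ⟨i, rfl⟩
      exact hu_mem i
    obtain ⟨b, hbt, hsb, htb, hbli⟩ := exists_linearIndepOn_id_extension hu_li.linearIndepOn_id hsub
    have hbfin : b.Finite := LinearIndependent.set_finite_of_isNoetherian hbli
    haveI : Finite ↥(b \ Set.range u) := (hbfin.subset Set.sdiff_subset).to_subtype
    -- lifts `(h, p^E) ∈ 𝕀`, `h ∈ 𝔪^{p^E}`, of the new basis vectors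
    have hlift : ∀ w : ↥(b \ Set.range u), ∃ (f : R) (hf : f ∈ maximalIdeal R ^ p ^ E),
        f ∈ 𝕀.level ((p ^ E : ℕ) : ℝ) ∧ gradedPiece.mk (maximalIdeal R) (p ^ E) ⟨f, hf⟩ =
          (w : gradedPiece (maximalIdeal R) (p ^ E)) := fun w => (hbt w.2.1).1
    choose lift hliftm hliftl hlifteq using hlift
    have hpow' : ∀ i', Sum.elim h lift i' ∈ maximalIdeal R ^ p ^ Sum.elim e (fun _ => E) i' := by
      rintro (i | w)
      exacts [hpow i, hliftm w]
    refine ⟨ι ⊕ ↥(b \ Set.range u), inferInstance, Sum.elim h lift, Sum.elim e (fun _ => E), hpow',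
      ?_, ?_, ?_, ?_⟩
    · rintro (i | w)
      exacts [Nat.lt_succ_of_lt (hlt i), Nat.lt_succ_self E]
    · rintro (i | w)
      exacts [hlev i, hliftl w]
    · rintro (i | w)
      · exact hpure i
      · show IsPure (p ^ E) (gradedPiece.mk (maximalIdeal R) (p ^ E) ⟨lift w, hliftm w⟩)
        rw [hlifteq w]
        exact (hbt w.2.1).2
    · intro e₀ he₀
      rcases (Nat.lt_succ_iff.mp he₀).lt_or_eq with hlt₀ | heq
      · -- a lower stage: only old indices occur
        obtain ⟨hli₀, hspan₀⟩ := hlow e₀ hlt₀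
        let ψ : {i : ι // e i ≤ e₀} →
            {i' : ι ⊕ ↥(b \ Set.range u) // Sum.elim e (fun _ => E) i' ≤ e₀} :=
          fun i => ⟨Sum.inl i.1, i.2⟩
        have hψ : Function.Bijective ψ := by
          refine ⟨fun i₁ i₂ h12 => Subtype.ext (Sum.inl_injective (congrArg Subtype.val h12)), ?_⟩
          rintro ⟨i' , hi'⟩
          rcases i' with i | w
          · exact ⟨⟨i, hi'⟩, rfl⟩
          · exact absurd hi' (by change ¬ (E ≤ e₀); omega)
        have hfam : lgsFamily p (Sum.elim h lift) (Sum.elim e fun _ => E) hpow' e₀ ∘ ψ =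
            lgsFamily p h e hpow e₀ := rfl
        refine ⟨(linearIndependent_equiv' (Equiv.ofBijective ψ hψ) hfam).mp hli₀, ?_⟩
        rw [← hspan₀, ← hfam, hψ.2.range_comp]
      · -- the new top stage `e₀ = E`
        subst heq
        have hall : ∀ i' : ι ⊕ ↥(b \ Set.range u), Sum.elim e (fun _ => e₀) i' ≤ e₀ := by
          rintro (i | w)
          exacts [hle i, le_rfl]
        let τ : {i' : ι ⊕ ↥(b \ Set.range u) // Sum.elim e (fun _ => e₀) i' ≤ e₀} ≃
            ι ⊕ ↥(b \ Set.range u) := Equiv.subtypeUnivEquiv hall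
        let g : ι ⊕ ↥(b \ Set.range u) → gradedPiece (maximalIdeal R) (p ^ e₀) :=
          Sum.elim u fun w => (w : gradedPiece (maximalIdeal R) (p ^ e₀))
        have hfam : lgsFamily p (Sum.elim h lift) (Sum.elim e fun _ => e₀) hpow' e₀ = g ∘ τ := by
          funext ⟨i', hi'⟩
          rcases i' with i | w
          · rfl
          · change gradedPiece.mk (maximalIdeal R) (p ^ e₀) ⟨lift w ^ p ^ (e₀ - e₀), _⟩ =
              (w : gradedPiece (maximalIdeal R) (p ^ e₀))
            rw [← hlifteq w]
            congr 1
            exact Subtype.ext (by simp)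
        have hg_range : Set.range g = b := by
          rw [Set.Sum.elim_range, Subtype.range_coe, Set.union_sdiff_cancel hsb]
        have hg_inj : Function.Injective g :=
          hu_li.injective.sumElim Subtype.val_injective fun i w heq => w.2.2 ⟨i, heq⟩
        have hg_li : LinearIndependent (ResidueField R) g :=
          (linearIndepOn_id_range_iff hg_inj).mp (by rw [hg_range]; exact hbli)
        have hspanb : Submodule.span (ResidueField R) b = S :=
          le_antisymm (Submodule.span_le.mpr (hS.symm ▸ hbt)) fun x hx =>
            htb (show x ∈ pureLeading 𝕀 (p ^ e₀) from hS ▸ hx)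
        refine ⟨?_, ?_⟩
        · rw [hfam]
          exact (linearIndependent_equiv τ).mpr hg_li
        · rw [hfam, τ.surjective.range_comp, hg_range, hspanb, hS]

/-- **Kawanoue 2007, Lemma 3.1.2.1 («Moreover» part) / Prop. 3.1.3.2 — a leading generator system
EXISTS**, for ANY idealistic filtration `𝕀` over a regular local ring `(R, 𝔪)` of exponential
characteristic `p` whose residue field has `p`-th roots (in print: `R = 𝒪_{W,P}`, `W` smooth over
`k` algebraically closed): there are finitely many `(h_i, p^{e_i}) ∈ 𝕀`, `e_1 ≤ ⋯ ≤ e_N`, with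
`h̄_i ∈ L(𝕀)^{pure}_{p^{e_i}}` and `{h̄_i^{p^{e-e_i}} ; e_i ≤ e}` a basis of `L(𝕀)^{pure}_{p^e}` for
every `e` (Def. 3.1.3.1). PROOF AS PRINTED: the chain `{L^{pure}_{p^{e-1}}}^p ⊂ L^{pure}_{p^e}`
(`pureLeading_pow`) of subspaces (`exists_submodule_coe_eq_pureLeading`) of dimension `≤ dim G_1`
(`lPure_le_of_span_eq`) stabilises; bases are chosen stage by stage (`exists_partialLGS`), the
Frobenius of `G` preserving linear independence because `G ≅ k[x]` is a domain (`indep_frobenius`,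
via the order valuation of the regular local ring); above the stage where `dim L^{pure}_{p^e}` is
maximal the Frobenius images remain bases by counting dimensions. NOTE: conditions (i)(ii) of
Def. 3.1.3.1 do not involve 𝔇-saturation, and neither does this existence argument — the printed
standing hypothesis «𝔇-saturated» is what makes `L(𝕀) = k[L^{pure}]` (first part of Lemma 3.1.2.1),
i.e. makes the system GENERATE `L(𝕀)`; that part is not asserted here.
[cite: Kawanoue2007, Prop. 3.1.3.2 with Lemma 3.1.2.1 («Moreover» part)] -/
theorem exists_isLGS (p : ℕ) [ExpChar R p] (hF : ∀ c : ResidueField R, ∃ d, d ^ p = c)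
    (𝕀 : IdealisticFiltration R) :
    ∃ (N : ℕ) (h : Fin N → R) (e : Fin N → ℕ), Monotone e ∧ IsLGS p 𝕀 h e := by
  classical
  obtain ⟨E, hE⟩ := exists_forall_lPure_le p 𝕀
  obtain ⟨ι, _, h, e, hpow, hlt, hlev, hpure, hlow⟩ := exists_partialLGS p hF 𝕀 (E + 1)
  letI : Fintype ι := Fintype.ofFinite ι
  have hle : ∀ i, e i ≤ E := fun i => Nat.lt_succ_iff.mp (hlt i)
  obtain ⟨hliE, hspanE⟩ := hlow E (Nat.lt_succ_self E)
  -- `l^{pure}_{p^E} = #ι`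
  have hcardE : lPure 𝕀 (p ^ E) = Fintype.card ι := by
    rw [lPure, ← hspanE, Submodule.span_eq, finrank_span_eq_card hliE]
    exact Fintype.card_congr (Equiv.subtypeUnivEquiv hle)
  -- linear independence at every stage
  have hli : ∀ e₀, LinearIndependent (ResidueField R) (lgsFamily p h e hpow e₀) := by
    intro e₀
    rcases Nat.lt_or_ge E e₀ with h₀ | h₀
    swap
    · exact (hlow e₀ (Nat.lt_succ_of_le h₀)).1
    · -- above the top stage: Frobenius images of the stage-`E` basis
      have hmE : ∀ i, h i ^ p ^ (E - e i) ∈ maximalIdeal R ^ p ^ E := fun i =>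
        pow_mem_pow_of_le p (hle i) (hpow i)
      have hliE' : LinearIndependent (ResidueField R) (fun i : ι =>
          gradedPiece.mk (maximalIdeal R) (p ^ E) ⟨h i ^ p ^ (E - e i), hmE i⟩) :=
        hliE.comp (fun i : ι => (⟨i, hle i⟩ : {i : ι // e i ≤ E}))
          fun i₁ i₂ h12 => by simpa using congrArg Subtype.val h12
      have hcrit := (linearIndependent_mk_iff (p ^ E) _ hmE).mp hliE'
      have hcrit2 := indep_frobenius_pow p hF (p ^ E) _ hmE hcrit (e₀ - E)
      have e1 : ∀ i, (h i ^ p ^ (E - e i)) ^ p ^ (e₀ - E) = h i ^ p ^ (e₀ - e i) := fun i => by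
        rw [← pow_mul, ← pow_add]
        congr 2
        have := hle i
        omega
      have e2 : p ^ E * p ^ (e₀ - E) = p ^ e₀ := by
        rw [← pow_add]
        congr 1
        omega
      simp only [e1, e2] at hcrit2
      have hm₀ : ∀ i, h i ^ p ^ (e₀ - e i) ∈ maximalIdeal R ^ p ^ e₀ := fun i =>
        pow_mem_pow_of_le p ((hle i).trans h₀.le) (hpow i)
      have := (linearIndependent_mk_iff (p ^ e₀) _ hm₀).mpr hcrit2
      exact this.comp (fun i : {i : ι // e i ≤ e₀} => (i : ι)) Subtype.val_injective
  -- spanning at every stage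
  have hspan : ∀ e₀, (Submodule.span (ResidueField R) (Set.range (lgsFamily p h e hpow e₀)) :
      Set (gradedPiece (maximalIdeal R) (p ^ e₀))) = pureLeading 𝕀 (p ^ e₀) := by
    intro e₀
    rcases Nat.lt_or_ge E e₀ with h₀ | h₀
    swap
    · exact (hlow e₀ (Nat.lt_succ_of_le h₀)).2
    · obtain ⟨S, hS⟩ := exists_submodule_coe_eq_pureLeading p hF 𝕀 e₀
      have h1 : Submodule.span (ResidueField R) (Set.range (lgsFamily p h e hpow e₀)) ≤ S := by
        refine Submodule.span_le.mpr ?_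
        rintro _ ⟨i, rfl⟩
        rw [hS]
        obtain ⟨hm', hl', hp'⟩ := pureLeading_pow p 𝕀 (e' := e₀) (j := e₀ - e i)
          (by have := (hle i).trans h₀.le; omega) (hpow i) (hlev i) (hpure i)
        exact ⟨mk_mem_leadingModule hm' hl', hp'⟩
      have h2 : Module.finrank (ResidueField R) S ≤
          Module.finrank (ResidueField R)
            (Submodule.span (ResidueField R) (Set.range (lgsFamily p h e hpow e₀))) := by
        rw [← lPure_eq_finrank_of_coe_eq hS, finrank_span_eq_card (hli e₀),
          Fintype.card_congr (Equiv.subtypeUnivEquiv fun i => (hle i).trans h₀.le), ← hcardE]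
        exact hE e₀
      rw [Submodule.eq_of_le_of_finrank_le h1 h2, hS]
  have H : IsLGS p 𝕀 h e :=
    { level_mem := hlev
      pow_mem := hpow
      pure := fun i => ⟨mk_mem_leadingModule (hpow i) (hlev i), hpure i⟩
      injective := fun e₀ => (hli e₀).injective
      linearIndependent := hli
      span_eq := hspan }
  -- re-index by `Fin N`, sorted by the exponents
  let σ : Fin (Fintype.card ι) ≃ ι := (Fintype.equivFin ι).symm
  have H1 : IsLGS p 𝕀 (h ∘ σ) (e ∘ σ) := H.comp_equiv σ
  have H2 := H1.comp_equiv (Tuple.sort (e ∘ σ))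
  exact ⟨Fintype.card ι, _, _, Tuple.monotone_sort (e ∘ σ), H2⟩

end Existence

/-! ## The discharge of the named fact -/

section Discharge

/-- At a closed point of a variety over an algebraically closed field `k` the residue field of the
local ring is `k` (Nullstellensatz), so it has `p`-th roots. [folklore] -/
private theorem residueField_atPrime_exists_pow_eq (p : ℕ) (k : Type u) [Field k] [IsAlgClosed k]
    [ExpChar k p] (A : Type u) [CommRing A] [Algebra k A] [Algebra.FiniteType k A]
    (𝔫 : Ideal A) [𝔫.IsMaximal] (c : ResidueField (Localization.AtPrime 𝔫)) : ∃ d, d ^ p = c := by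
  letI : Field (A ⧸ 𝔫) := Ideal.Quotient.field 𝔫
  haveI : Module.Finite k (A ⧸ 𝔫) := finite_of_finite_type_of_isJacobsonRing k (A ⧸ 𝔫)
  haveI : Algebra.IsIntegral k (A ⧸ 𝔫) := Algebra.IsIntegral.of_finite k _
  have hbij := IsAlgClosed.algebraMap_bijective_of_isIntegral (k := k) (K := A ⧸ 𝔫)
  let ε := IsLocalization.AtPrime.equivQuotMaximalIdeal 𝔫 (Localization.AtPrime 𝔫)
  change ∃ d : Localization.AtPrime 𝔫 ⧸ maximalIdeal (Localization.AtPrime 𝔫), d ^ p = c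
  obtain ⟨a, ha⟩ := hbij.2 (ε.symm c)
  obtain ⟨b, hb⟩ := IsAlgClosed.exists_pow_nat_eq a (expChar_pos k p)
  refine ⟨ε (algebraMap k (A ⧸ 𝔫) b), ?_⟩
  rw [← map_pow, ← map_pow, hb, ha, RingEquiv.apply_symm_apply]

/-- **DISCHARGE of the named fact `Kawanoue2007_prop_3_1_3_2`** (Kawanoue 2007, Prop. 3.1.3.2): for
`k` algebraically closed with `ExpChar k p`, `A` a smooth finitely generated `k`-domain, `𝔫` maximal
and `𝕀` a (𝔇-saturated) idealistic filtration over `R = A_𝔫`, a leading generator system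
`{(h_i, p^{e_i})}_{i < N}` with `e` monotone exists. `R` is a regular local ring (smooth over a field
⇒ regular, `isRegularLocalRing_of_isSmoothAt`), of exponential characteristic `p`, with residue field
`k` (Nullstellensatz); then `exists_isLGS` (the printed proof: Lemma 3.1.2.1, «Moreover» part). The
𝔇-saturation hypothesis of the fact is not needed for EXISTENCE (it is what makes the system
generate `L(𝕀)`). [cite: Kawanoue2007, Prop. 3.1.3.2 with Lemma 3.1.2.1] -/
theorem Kawanoue2007_prop_3_1_3_2_holds : Kawanoue2007_prop_3_1_3_2.{u} := by
  intro p k _ _ _ A _ _ _ _ _ 𝔫 _ 𝕀 _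
  haveI : IsRegularLocalRing (Localization.AtPrime 𝔫) :=
    Literature.AlgebraicGeometry.Resolution.isRegularLocalRing_of_isSmoothAt k A 𝔫
  haveI : ExpChar (Localization.AtPrime 𝔫) p :=
    expChar_of_injective_algebraMap (algebraMap k (Localization.AtPrime 𝔫)).injective p
  exact exists_isLGS p (residueField_atPrime_exists_pow_eq p k A 𝔫) 𝕀

end Discharge

/-! ## Kawanoue 2007 Ch. 3 introduction / KM 2010 Rem. 1.1.1.2 (2): `0 ≤ l^{pure}_{p^0} ≤ l^{pure}_{p^1} ≤ ⋯ ≤ d`, i.e. `σ(e) ≥ 0` and `σ` non-increasing -/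

section SigmaBounds

variable {R : Type u} [CommRing R]

/-- **`l^{pure}_{p^e} ≤ ` the minimal number of generators of `𝔪`** (Noetherian local ring of exponential
characteristic `p`): «`dim_k L_{p^e}^{pure} ≤ dim G_1 = d`». [cite: Kawanoue2007, Lemma 3.1.2.1 (proof, «Moreover» part); KawanoueMatsuki2010, Rem. 1.1.1.2 (2)] -/
theorem lPure_le_spanFinrank [IsLocalRing R] [IsNoetherianRing R] (p : ℕ) [ExpChar R p]
    (𝕀 : IdealisticFiltration R) (e : ℕ) :
    lPure 𝕀 (p ^ e) ≤ (maximalIdeal R).spanFinrank := by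
  obtain ⟨s, hcard, hspan⟩ := Submodule.FG.exists_span_finset_card_eq_spanFinrank
    (IsNoetherian.noetherian (maximalIdeal R))
  let x : Fin s.card → R := fun i => (s.equivFin.symm i : R)
  have hx : Ideal.span (Set.range x) = maximalIdeal R := by
    have : Set.range x = (s : Set R) := by
      rw [show x = Subtype.val ∘ s.equivFin.symm from rfl, s.equivFin.symm.surjective.range_comp,
        Subtype.range_coe_subtype]
      rfl
    rw [this]
    exact hspan
  rw [← hcard]
  exact lPure_le_of_span_eq p 𝕀 x hx e

/-- **`l^{pure}_{p^e} ≤ dim R`** for a regular local ring (`𝔪` is generated by `dim R` elements): «`dim_k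
L(𝕀)^{pure}_{p^e} ≤ dim W` for any `e`», whence «`σ(e) ∈ ℤ_{≥0}`». [cite: Kawanoue2007, Ch. 3 introduction and Def. 3.2.1.1; KawanoueMatsuki2010, Rem. 1.1.1.2 (2)] -/
theorem lPure_le_ringKrullDim [IsRegularLocalRing R] (p : ℕ) [ExpChar R p] (𝕀 : IdealisticFiltration R) (e : ℕ) :
    (lPure 𝕀 (p ^ e) : WithBot ℕ∞) ≤ ringKrullDim R := by
  rw [← IsRegularLocalRing.spanFinrank_maximalIdeal]
  exact_mod_cast lPure_le_spanFinrank p 𝕀 e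

/-- **`σ(e) ≥ 0`** when `d` is (at least) the minimal number of generators of `𝔪` — in print `d = dim W = dim R`
for the regular local ring `R = 𝒪_{W,P}`, where `(maximalIdeal R).spanFinrank = d`. [cite: Kawanoue2007, Def. 3.2.1.1 («`σ : ℤ_{≥0} → ℤ_{≥0}`»); KawanoueMatsuki2010, Rem. 1.1.1.2 (2)] -/
theorem sigma_nonneg [IsLocalRing R] [IsNoetherianRing R] (p : ℕ) [ExpChar R p] (𝕀 : IdealisticFiltration R)
    {d : ℕ} (hd : (maximalIdeal R).spanFinrank ≤ d) (e : ℕ) : 0 ≤ sigma p d 𝕀 e := by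
  rw [sigma_apply, sub_nonneg]
  exact_mod_cast (lPure_le_spanFinrank p 𝕀 e).trans hd

/-- **`l^{pure}_{p^e} ≤ l^{pure}_{p^{e+1}}`** over a regular local ring of exponential characteristic `p` whose
residue field has `p`-th roots: «The dimension of the pure part is non-decreasing as a function of `e`» — the
Frobenius `{L^{pure}_{p^e}}^p ⊂ L^{pure}_{p^{e+1}}` keeps a basis linearly independent (`indep_frobenius`).
[cite: KawanoueMatsuki2010, Rem. 1.1.1.2 (2); Kawanoue2007, Lemma 3.1.2.1 (proof, «Moreover» part)] -/
theorem lPure_le_lPure_succ [IsRegularLocalRing R] (p : ℕ) [ExpChar R p]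
    (hF : ∀ c : ResidueField R, ∃ d, d ^ p = c) (𝕀 : IdealisticFiltration R) (e : ℕ) :
    lPure 𝕀 (p ^ e) ≤ lPure 𝕀 (p ^ (e + 1)) := by
  classical
  -- a basis `b` of the pure part of degree `p^e`, inside the pure part
  obtain ⟨b, hbt, hspan, hbli⟩ := exists_linearIndependent (ResidueField R) (pureLeading 𝕀 (p ^ e))
  have hbfin : b.Finite := LinearIndependent.set_finite_of_isNoetherian hbli
  letI : Fintype b := hbfin.fintype
  have h1 : lPure 𝕀 (p ^ e) = Fintype.card b := by
    rw [lPure, ← hspan, finrank_span_set_eq_card hbli, Set.toFinset_card]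
  -- lifts `(f_w, p^e) ∈ 𝕀`, `f_w ∈ 𝔪^{p^e}`, `\bar f_w = w` pure
  have hlift : ∀ w : b, ∃ (f : R) (hf : f ∈ maximalIdeal R ^ p ^ e),
      f ∈ 𝕀.level ((p ^ e : ℕ) : ℝ) ∧ gradedPiece.mk (maximalIdeal R) (p ^ e) ⟨f, hf⟩ =
        (w : gradedPiece (maximalIdeal R) (p ^ e)) := fun w => (hbt w.2).1
  choose f hfm hfl hfeq using hlift
  have hfpure : ∀ w : b, IsPure (p ^ e) (gradedPiece.mk (maximalIdeal R) (p ^ e) ⟨f w, hfm w⟩) := fun w => by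
    rw [hfeq w]
    exact (hbt w.2).2
  -- the classes `\bar f_w` are linearly independent, hence so are the `\bar{f_w^p}`
  have hli : LinearIndependent (ResidueField R)
      (fun w : b => gradedPiece.mk (maximalIdeal R) (p ^ e) ⟨f w, hfm w⟩) := by
    have : (fun w : b => gradedPiece.mk (maximalIdeal R) (p ^ e) ⟨f w, hfm w⟩) =
        fun w : b => (w : gradedPiece (maximalIdeal R) (p ^ e)) := funext hfeq
    rw [this]
    exact hbli
  have hcrit := indep_frobenius p hF (p ^ e) f hfm ((linearIndependent_mk_iff (p ^ e) f hfm).mp hli)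
  rw [← pow_succ] at hcrit
  obtain ⟨S, hS⟩ := exists_submodule_coe_eq_pureLeading p hF 𝕀 (e + 1)
  have hmem : ∀ w : b, ∃ hm' : f w ^ p ∈ maximalIdeal R ^ p ^ (e + 1),
      f w ^ p ∈ 𝕀.level ((p ^ (e + 1) : ℕ) : ℝ) ∧
      IsPure (p ^ (e + 1)) (gradedPiece.mk (maximalIdeal R) (p ^ (e + 1)) ⟨f w ^ p, hm'⟩) := fun w => by
    simpa only [pow_one] using pureLeading_pow p 𝕀 (j := 1) rfl (hfm w) (hfl w) (hfpure w)
  have hm' : ∀ w : b, f w ^ p ∈ maximalIdeal R ^ p ^ (e + 1) := fun w => (hmem w).1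
  have hli' : LinearIndependent (ResidueField R)
      (fun w : b => gradedPiece.mk (maximalIdeal R) (p ^ (e + 1)) ⟨f w ^ p, hm' w⟩) :=
    (linearIndependent_mk_iff (p ^ (e + 1)) _ hm').mpr hcrit
  have hle : Submodule.span (ResidueField R)
      (Set.range fun w : b => gradedPiece.mk (maximalIdeal R) (p ^ (e + 1)) ⟨f w ^ p, hm' w⟩) ≤ S := by
    refine Submodule.span_le.mpr ?_
    rintro _ ⟨w, rfl⟩
    rw [hS]
    obtain ⟨hm'', hl'', hp''⟩ := hmem w
    exact ⟨mk_mem_leadingModule hm'' hl'', hp''⟩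
  calc lPure 𝕀 (p ^ e) = Fintype.card b := h1
    _ = Module.finrank (ResidueField R) (Submodule.span (ResidueField R)
          (Set.range fun w : b => gradedPiece.mk (maximalIdeal R) (p ^ (e + 1)) ⟨f w ^ p, hm' w⟩)) :=
        (finrank_span_eq_card hli').symm
    _ ≤ Module.finrank (ResidueField R) S := Submodule.finrank_mono hle
    _ = lPure 𝕀 (p ^ (e + 1)) := (lPure_eq_finrank_of_coe_eq hS).symm

/-- Hence `e ↦ l^{pure}_{p^e}` is monotone. [cite: KawanoueMatsuki2010, Rem. 1.1.1.2 (2)] -/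
theorem monotone_lPure [IsRegularLocalRing R] (p : ℕ) [ExpChar R p]
    (hF : ∀ c : ResidueField R, ∃ d, d ^ p = c) (𝕀 : IdealisticFiltration R) :
    Monotone fun e => lPure 𝕀 (p ^ e) :=
  monotone_nat_of_le_succ fun e => lPure_le_lPure_succ p hF 𝕀 e

/-- … and `σ` is non-increasing: `σ(e+1) ≤ σ(e)`. [cite: KawanoueMatsuki2010, Rem. 1.1.1.2 (2); Kawanoue2007, Def. 3.2.1.1] -/
theorem antitone_sigma [IsRegularLocalRing R] (p : ℕ) [ExpChar R p]
    (hF : ∀ c : ResidueField R, ∃ d, d ^ p = c) (d : ℕ) (𝕀 : IdealisticFiltration R) :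
    Antitone (sigma p d 𝕀) := fun e₁ e₂ h => by
  rw [sigma_apply, sigma_apply]
  have := monotone_lPure p hF 𝕀 h
  simp only at this
  omega

/-- «… and hence stabilizes after some point, i.e., there exists `e_M` such that for `e > e_M` the above
inequalities become equalities». [cite: KawanoueMatsuki2010, Rem. 1.1.1.2 (2); Kawanoue2007, Lemma 3.1.2.1 (proof, «Moreover» part)] -/
theorem exists_forall_lPure_eq [IsRegularLocalRing R] (p : ℕ) [ExpChar R p]
    (hF : ∀ c : ResidueField R, ∃ d, d ^ p = c) (𝕀 : IdealisticFiltration R) :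
    ∃ E : ℕ, ∀ e, E ≤ e → lPure 𝕀 (p ^ e) = lPure 𝕀 (p ^ E) := by
  obtain ⟨E, hE⟩ := exists_forall_lPure_le p 𝕀
  exact ⟨E, fun e he => le_antisymm (hE e) (monotone_lPure p hF 𝕀 he)⟩

end SigmaBounds

/-! ## «condition (ii) implies #ℍ ≤ dim W» (Ch. 3 introduction, chunk p0079 L5) -/

section CardBound

variable {R : Type u} [CommRing R] [IsLocalRing R]

/-- The members `h̄_i^{p^{e₀-e_i}}` (`e_i ≤ e₀`) of a system satisfying condition (i) lie in the pure part
`L(𝕀)^{pure}_{p^{e₀}}` (exponential characteristic `p`). [cite: Kawanoue2007, Def. 3.1.3.1 (i) with Rem. 3.1.3.3 (2)] -/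
theorem IsWeakLGS.lgsFamily_mem_pureLeading (p : ℕ) [ExpChar R p] {𝕀 : IdealisticFiltration R} {ι : Type*}
    {h : ι → R} {e : ι → ℕ} (H : IsWeakLGS p 𝕀 h e) (e₀ : ℕ) (i : {i : ι // e i ≤ e₀}) :
    lgsFamily p h e H.pow_mem e₀ i ∈ pureLeading 𝕀 (p ^ e₀) := by
  obtain ⟨hm', hl', hp'⟩ :=
    pureLeading_pow p 𝕀 (Nat.add_sub_cancel' i.2) (H.pow_mem i) (H.level_mem i) (H.pure i).2
  exact ⟨mk_mem_leadingModule hm' hl', hp'⟩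

/-- For a system satisfying (i) and the weak form of (ii) (linear independence), `#{i ; e_i ≤ e₀} ≤ l^{pure}_{p^{e₀}}`.
[cite: Kawanoue2007, Rem. 3.1.3.3 (2) with Def. 3.2.1.1] -/
theorem IsWeakLGS.card_le_lPure [IsNoetherianRing R] (p : ℕ) [ExpChar R p] {𝕀 : IdealisticFiltration R}
    {ι : Type*} {h : ι → R} {e : ι → ℕ} (H : IsWeakLGS p 𝕀 h e) (e₀ : ℕ) [Fintype {i : ι // e i ≤ e₀}] :
    Fintype.card {i : ι // e i ≤ e₀} ≤ lPure 𝕀 (p ^ e₀) := by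
  have hmem : Set.range (lgsFamily p h e H.pow_mem e₀) ⊆ pureLeading 𝕀 (p ^ e₀) := by
    rintro _ ⟨i, rfl⟩
    exact H.lgsFamily_mem_pureLeading p e₀ i
  rw [lPure, ← finrank_span_eq_card (H.linearIndependent e₀)]
  exact Submodule.finrank_mono (Submodule.span_mono hmem)

/-- **«condition (ii) implies `#ℍ ≤ dim W`»** in the form `#ℍ ≤ ` the minimal number of generators of `𝔪`, for any
FINITE system satisfying (i) and the weak (ii) over a Noetherian local ring of exponential characteristic `p`
(so in Setting 4.1.1, `N ≤ d`). [cite: Kawanoue2007, Ch. 3 introduction («condition (ii) implies #ℍ ≤ dim W»); Rem. 3.1.3.3 (2)] -/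
theorem IsWeakLGS.card_le_spanFinrank [IsNoetherianRing R] (p : ℕ) [ExpChar R p] {𝕀 : IdealisticFiltration R}
    {ι : Type*} [Fintype ι] {h : ι → R} {e : ι → ℕ} (H : IsWeakLGS p 𝕀 h e) :
    Fintype.card ι ≤ (maximalIdeal R).spanFinrank := by
  classical
  have he₀ : ∀ i, e i ≤ Finset.univ.sup e := fun i => Finset.le_sup (Finset.mem_univ i)
  calc Fintype.card ι = Fintype.card {i : ι // e i ≤ Finset.univ.sup e} :=
        (Fintype.card_congr (Equiv.subtypeUnivEquiv he₀)).symm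
    _ ≤ lPure 𝕀 (p ^ Finset.univ.sup e) := H.card_le_lPure p _
    _ ≤ (maximalIdeal R).spanFinrank := lPure_le_spanFinrank p 𝕀 _

/-- **«condition (ii) implies `#ℍ ≤ dim W`»** for a finite leading generator system over a Noetherian local ring
of exponential characteristic `p`: `#ℍ ≤ ` the minimal number of generators of `𝔪`.
[cite: Kawanoue2007, Ch. 3 introduction («condition (ii) implies #ℍ ≤ dim W»)] -/
theorem IsLGS.card_le_spanFinrank [IsNoetherianRing R] (p : ℕ) [ExpChar R p] {𝕀 : IdealisticFiltration R}
    {ι : Type*} [Fintype ι] {h : ι → R} {e : ι → ℕ} (H : IsLGS p 𝕀 h e) :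
    Fintype.card ι ≤ (maximalIdeal R).spanFinrank :=
  H.isWeakLGS.card_le_spanFinrank p

/-- … and `#ℍ ≤ dim R` over a regular local ring (`= dim W` for `R = 𝒪_{W,P}`).
[cite: Kawanoue2007, Ch. 3 introduction («condition (ii) implies #ℍ ≤ dim W»)] -/
theorem IsLGS.card_le_ringKrullDim {R : Type u} [CommRing R] [IsRegularLocalRing R] (p : ℕ) [ExpChar R p]
    {𝕀 : IdealisticFiltration R} {ι : Type*} [Fintype ι] {h : ι → R} {e : ι → ℕ} (H : IsLGS p 𝕀 h e) :
    (Fintype.card ι : WithBot ℕ∞) ≤ ringKrullDim R := by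
  rw [← IsRegularLocalRing.spanFinrank_maximalIdeal]
  exact_mod_cast H.card_le_spanFinrank p

end CardBound


/-! ## The completion case of Prop. 3.1.3.2 («`R` … or its completion», Ch. 3 setting p0077 L11) -/

section Completion

/-- **Leading generator systems over the completion.** For a regular local ring `(R, 𝔪)` of exponential
characteristic `p` whose residue field has `p`-th roots, EVERY idealistic filtration over the `𝔪`-adic
completion `R̂` has a leading generator system: `R̂` is again a regular local ring
(`Resolution.isRegularLocalRing_adicCompletion`, Matsumura §19) with the same residue field
(Mathlib `AdicCompletion.residueField_map_bijective`), so `exists_isLGS` applies. This is the «or its completion»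
clause of the Chapter 3 setting (chunk p0077 L11) for Prop. 3.1.3.2.
[cite: Kawanoue2007, Prop. 3.1.3.2 with the setting of Ch. 3 («or its completion»)] -/
theorem exists_isLGS_adicCompletion {R : Type u} [CommRing R] [IsRegularLocalRing R] (p : ℕ) [ExpChar R p]
    (hF : ∀ c : ResidueField R, ∃ d, d ^ p = c)
    (𝕀 : IdealisticFiltration (AdicCompletion (maximalIdeal R) R)) :
    ∃ (N : ℕ) (h : Fin N → AdicCompletion (maximalIdeal R) R) (e : Fin N → ℕ), Monotone e ∧ IsLGS p 𝕀 h e := by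
  haveI := Literature.AlgebraicGeometry.Resolution.isRegularLocalRing_adicCompletion R
  have hinj : Function.Injective (algebraMap R (AdicCompletion (maximalIdeal R) R)) :=
    AdicCompletion.of_injective (maximalIdeal R) R
  haveI : ExpChar (AdicCompletion (maximalIdeal R) R) p := expChar_of_injective_ringHom hinj p
  refine exists_isLGS p (fun c => ?_) 𝕀
  obtain ⟨c₀, rfl⟩ := (AdicCompletion.residueField_map_bijective R).2 c
  obtain ⟨d₀, hd₀⟩ := hF c₀
  exact ⟨IsLocalRing.ResidueField.map _ d₀, by rw [← map_pow, hd₀]⟩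

/-- **Prop. 3.1.3.2, completion case of the fact's setting** (the `-- TODO(general form): R = Â_𝔫` of
`Kawanoue2007_prop_3_1_3_2`): for `k` algebraically closed with `ExpChar k p`, `A` a smooth finitely generated
`k`-algebra, `𝔫 ⊂ A` maximal, every idealistic filtration over the completion `(A_𝔫)^` of `R = A_𝔫` has a
leading generator system `{(h_i, p^{e_i})}_{i < N}` with monotone exponents. As for `R = A_𝔫`, no 𝔇-saturation
hypothesis is needed for existence. [cite: Kawanoue2007, Prop. 3.1.3.2 with the setting of Ch. 3 (p0077 L11, «or its completion»)] -/
theorem Kawanoue2007_prop_3_1_3_2_adicCompletion (p : ℕ) (k : Type u) [Field k] [IsAlgClosed k] [ExpChar k p]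
    (A : Type u) [CommRing A] [IsNoetherianRing A] [Algebra k A] [Algebra.FiniteType k A] [Algebra.Smooth k A]
    (𝔫 : Ideal A) [𝔫.IsMaximal]
    (𝕀 : IdealisticFiltration
      (AdicCompletion (maximalIdeal (Localization.AtPrime 𝔫)) (Localization.AtPrime 𝔫))) :
    ∃ (N : ℕ) (h : Fin N → AdicCompletion (maximalIdeal (Localization.AtPrime 𝔫)) (Localization.AtPrime 𝔫))
      (e : Fin N → ℕ), Monotone e ∧ IsLGS p 𝕀 h e := by
  haveI : IsRegularLocalRing (Localization.AtPrime 𝔫) :=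
    Literature.AlgebraicGeometry.Resolution.isRegularLocalRing_of_isSmoothAt k A 𝔫
  haveI : ExpChar (Localization.AtPrime 𝔫) p :=
    expChar_of_injective_algebraMap (algebraMap k (Localization.AtPrime 𝔫)).injective p
  exact exists_isLGS_adicCompletion p (residueField_atPrime_exists_pow_eq p k A 𝔫) 𝕀

end Completion

/-! ## The printed setting `R = 𝒪_{W,P}` (`W` smooth over `k = k̄`): existence and bounds with `d = dim W`, for ANY filtration -/

section ClosedPoint

/-- The embedding dimension of `R = A_𝔫` is at most `dim A`: `A_𝔫` is regular, so
`emb.dim A_𝔫 = dim A_𝔫 = ht 𝔫 ≤ dim A`. [folklore] -/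
private theorem spanFinrank_maximalIdeal_atPrime_le (p : ℕ) (k : Type u) [Field k] [IsAlgClosed k] [ExpChar k p]
    (A : Type u) [CommRing A] [Algebra k A] [Algebra.FiniteType k A] [Algebra.Smooth k A]
    (𝔫 : Ideal A) [𝔫.IsMaximal] {d : ℕ} (hd : ringKrullDim A = d) :
    (maximalIdeal (Localization.AtPrime 𝔫)).spanFinrank ≤ d := by
  haveI : IsRegularLocalRing (Localization.AtPrime 𝔫) :=
    Literature.AlgebraicGeometry.Resolution.isRegularLocalRing_of_isSmoothAt k A 𝔫
  have h1 : ((maximalIdeal (Localization.AtPrime 𝔫)).spanFinrank : WithBot ℕ∞) =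
      ringKrullDim (Localization.AtPrime 𝔫) := IsRegularLocalRing.spanFinrank_maximalIdeal
  have h2 : ringKrullDim (Localization.AtPrime 𝔫) = 𝔫.height :=
    IsLocalization.AtPrime.ringKrullDim_eq_height 𝔫 (Localization.AtPrime 𝔫)
  have h3 : (𝔫.height : WithBot ℕ∞) ≤ ringKrullDim A :=
    Ideal.height_le_ringKrullDim_of_ne_top Ideal.IsPrime.ne_top'
  have h4 : ((maximalIdeal (Localization.AtPrime 𝔫)).spanFinrank : WithBot ℕ∞) ≤ d := by
    rw [h1, h2, ← hd]
    exact h3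
  exact_mod_cast h4

/-- **Prop. 3.1.3.2 in the printed setting, for ANY idealistic filtration over `R = A_𝔫`** (`A` smooth of
finite type over `k` algebraically closed of exponential characteristic `p`, `𝔫` maximal): a leading generator
system `{(h_i, p^{e_i})}_{i < N}` with `e` monotone exists — the form in which Kawanoue–Matsuki 2010 §3.1.1 use it
(«Take a leading generator system `ℍ` … for `𝕀_P`», arXiv:math/0612008 chunk p0041 L25), with the 𝔇-saturation
binder of the fact dropped (it is not used for existence, see `exists_isLGS`).
[cite: Kawanoue2007, Prop. 3.1.3.2; KawanoueMatsuki2010, §3.1.1] -/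
theorem exists_isLGS_of_smooth (p : ℕ) (k : Type u) [Field k] [IsAlgClosed k] [ExpChar k p]
    (A : Type u) [CommRing A] [Algebra k A] [Algebra.FiniteType k A] [Algebra.Smooth k A]
    (𝔫 : Ideal A) [𝔫.IsMaximal] (𝕀 : IdealisticFiltration (Localization.AtPrime 𝔫)) :
    ∃ (N : ℕ) (h : Fin N → Localization.AtPrime 𝔫) (e : Fin N → ℕ), Monotone e ∧ IsLGS p 𝕀 h e := by
  haveI : IsRegularLocalRing (Localization.AtPrime 𝔫) :=
    Literature.AlgebraicGeometry.Resolution.isRegularLocalRing_of_isSmoothAt k A 𝔫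
  haveI : ExpChar (Localization.AtPrime 𝔫) p :=
    expChar_of_injective_algebraMap (algebraMap k (Localization.AtPrime 𝔫)).injective p
  exact exists_isLGS p (residueField_atPrime_exists_pow_eq p k A 𝔫) 𝕀

/-- **«`dim_k L(𝕀)^{pure}_{p^e} ≤ dim W`»** at a closed point of `W = Spec A` (`d = dim A`).
[cite: Kawanoue2007, Ch. 3 introduction («Note that we have dim_k L(𝕀)^{pure}_{p^e} ≤ dim W»); KawanoueMatsuki2010, Rem. 1.1.1.2 (2)] -/
theorem lPure_le_of_smooth (p : ℕ) (k : Type u) [Field k] [IsAlgClosed k] [ExpChar k p]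
    (A : Type u) [CommRing A] [Algebra k A] [Algebra.FiniteType k A] [Algebra.Smooth k A]
    (𝔫 : Ideal A) [𝔫.IsMaximal] {d : ℕ} (hd : ringKrullDim A = d)
    (𝕀 : IdealisticFiltration (Localization.AtPrime 𝔫)) (e : ℕ) : lPure 𝕀 (p ^ e) ≤ d := by
  haveI : IsRegularLocalRing (Localization.AtPrime 𝔫) :=
    Literature.AlgebraicGeometry.Resolution.isRegularLocalRing_of_isSmoothAt k A 𝔫
  haveI : ExpChar (Localization.AtPrime 𝔫) p :=
    expChar_of_injective_algebraMap (algebraMap k (Localization.AtPrime 𝔫)).injective p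
  exact (lPure_le_spanFinrank p 𝕀 e).trans (spanFinrank_maximalIdeal_atPrime_le p k A 𝔫 hd)

/-- **«`σ(e) ∈ ℤ_{≥0}`»** with `d = dim W` at a closed point of `W = Spec A`.
[cite: Kawanoue2007, Def. 3.2.1.1; KawanoueMatsuki2010, Def. 1.1.1.1 with Rem. 1.1.1.2 (2)] -/
theorem sigma_nonneg_of_smooth (p : ℕ) (k : Type u) [Field k] [IsAlgClosed k] [ExpChar k p]
    (A : Type u) [CommRing A] [Algebra k A] [Algebra.FiniteType k A] [Algebra.Smooth k A]
    (𝔫 : Ideal A) [𝔫.IsMaximal] {d : ℕ} (hd : ringKrullDim A = d)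
    (𝕀 : IdealisticFiltration (Localization.AtPrime 𝔫)) (e : ℕ) : 0 ≤ sigma p d 𝕀 e := by
  rw [sigma_apply, sub_nonneg]
  exact_mod_cast lPure_le_of_smooth p k A 𝔫 hd 𝕀 e

/-- **«The dimension of the pure part is non-decreasing as a function of `e`»** at a closed point of `W`.
[cite: KawanoueMatsuki2010, Rem. 1.1.1.2 (2)] -/
theorem monotone_lPure_of_smooth (p : ℕ) (k : Type u) [Field k] [IsAlgClosed k] [ExpChar k p]
    (A : Type u) [CommRing A] [Algebra k A] [Algebra.FiniteType k A] [Algebra.Smooth k A]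
    (𝔫 : Ideal A) [𝔫.IsMaximal] (𝕀 : IdealisticFiltration (Localization.AtPrime 𝔫)) :
    Monotone fun e => lPure 𝕀 (p ^ e) := by
  haveI : IsRegularLocalRing (Localization.AtPrime 𝔫) :=
    Literature.AlgebraicGeometry.Resolution.isRegularLocalRing_of_isSmoothAt k A 𝔫
  haveI : ExpChar (Localization.AtPrime 𝔫) p :=
    expChar_of_injective_algebraMap (algebraMap k (Localization.AtPrime 𝔫)).injective p
  exact monotone_lPure p (residueField_atPrime_exists_pow_eq p k A 𝔫) 𝕀

/-- Hence `σ` is non-increasing at a closed point of `W`. [cite: KawanoueMatsuki2010, Rem. 1.1.1.2 (2)] -/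
theorem antitone_sigma_of_smooth (p : ℕ) (k : Type u) [Field k] [IsAlgClosed k] [ExpChar k p]
    (A : Type u) [CommRing A] [Algebra k A] [Algebra.FiniteType k A] [Algebra.Smooth k A]
    (𝔫 : Ideal A) [𝔫.IsMaximal] (d : ℕ) (𝕀 : IdealisticFiltration (Localization.AtPrime 𝔫)) :
    Antitone (sigma p d 𝕀) := by
  haveI : IsRegularLocalRing (Localization.AtPrime 𝔫) :=
    Literature.AlgebraicGeometry.Resolution.isRegularLocalRing_of_isSmoothAt k A 𝔫
  haveI : ExpChar (Localization.AtPrime 𝔫) p :=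
    expChar_of_injective_algebraMap (algebraMap k (Localization.AtPrime 𝔫)).injective p
  exact antitone_sigma p (residueField_atPrime_exists_pow_eq p k A 𝔫) d 𝕀

/-- … and «stabilizes after some point». [cite: KawanoueMatsuki2010, Rem. 1.1.1.2 (2)] -/
theorem exists_forall_lPure_eq_of_smooth (p : ℕ) (k : Type u) [Field k] [IsAlgClosed k] [ExpChar k p]
    (A : Type u) [CommRing A] [Algebra k A] [Algebra.FiniteType k A] [Algebra.Smooth k A]
    (𝔫 : Ideal A) [𝔫.IsMaximal] (𝕀 : IdealisticFiltration (Localization.AtPrime 𝔫)) :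
    ∃ E : ℕ, ∀ e, E ≤ e → lPure 𝕀 (p ^ e) = lPure 𝕀 (p ^ E) := by
  haveI : IsRegularLocalRing (Localization.AtPrime 𝔫) :=
    Literature.AlgebraicGeometry.Resolution.isRegularLocalRing_of_isSmoothAt k A 𝔫
  haveI : ExpChar (Localization.AtPrime 𝔫) p :=
    expChar_of_injective_algebraMap (algebraMap k (Localization.AtPrime 𝔫)).injective p
  exact exists_forall_lPure_eq p (residueField_atPrime_exists_pow_eq p k A 𝔫) 𝕀

end ClosedPoint

end Literature.AlgebraicGeometry.Kawanoue2007

end
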